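import Literature.Analysis.ValidatedNumerics.TaylorModelIntegralCert2DWeighted
import HarnessLib

/-!
# Duffy's transformation for vertex singularities, with kernel-checked certificates

Davis–Rabinowitz, *Methods of Numerical Integration* (2nd ed., Academic Press 1984), Sect. 5.8 treats integrands over
a square (hypercube) "with a specific kind of singularity at a vertex", `f(x) = r^α φ(θ) h(r) g(x)`, `α > −d`
(op. cit. (5.8.2)), and lists Duffy's transformation among the practical devices (Sect. 5.8, References: Duffy [1]).
Duffy, *Quadrature over a pyramid or cube of integrands with a singularity at a vertex*, SIAM J. Numer. Anal. 19
(1982) 1260–1262, splits the square along the diagonal through the singular vertex and maps the unit square onto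
each triangle by `(u, v) ↦ (u, u v)`; the Jacobian `u` of the map "eliminates singularities of the type `1/r`"
(Mousavi–Sukumar, Comput. Mech. 45 (2010) 127–140, Sect. 1 and Appendix A: "The Duffy transformation from a triangle
to a square is `x = u, y = x v = u v`"; "For the two-dimensional integral considered by Duffy, the integrand had a
`u^{-1/2}` term and therefore Gauss–Jacobi quadrature rule was used in the `u`-direction").

This module formalises exactly this reduction for a rational box `R = [x0, x1] × [y0, y1]` with the singular vertex
at `(x0, y0)` and composes it with the weighted kd-tree Taylor-model certificates of
`TaylorModelIntegralCert2DWeighted` (the Jacobi-type edge weight of that module plays the role of the Gauss–Jacobi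
rule in the `u`-direction):

* Part A — what a checked weighted certificate provides beyond the enclosure: JOINT integrability of the weighted
  integrand on the closed box, hence (Fubini) the iterated integral is the set integral over the box.
* Part B — Duffy's change of variables as an identity of SET integrals (Mathlib's change-of-variables theorem with
  the explicit Jacobian determinants `κ₁ (x − x0)` and `κ₂ (y − y0)`, `κ₁ = (y1 − y0)/(x1 − x0)`, `κ₂ = 1/κ₁`):
  `∫_R f = ∫_{x0}^{x1} ∫_0^1 κ₁ (x − x0) f(x, y0 + κ₁ (x − x0) s) ds dx + ∫_{y0}^{y1} ∫_0^1 κ₂ (y − y0) f(x0 + κ₂ (y − y0) s, y) ds dy`,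
  together with the transfer of integrability — NO hypothesis on `f` beyond integrability of the two transformed
  integrands on their closed boxes.
* Part C — the certificate: if the two transformed integrands agree on the OPEN boxes with weighted code-list
  integrands `wfun ωᵢ Bᵢ Fᵢ` whose kd-tree certificates check (`decide`), then `f` is integrable on `R` and
  `lo₁ + lo₂ ≤ ∫_{x0}^{x1} ∫_{y0}^{y1} f ≤ hi₁ + hi₂`.  Typical clients: `(x + y)^{-s}`, `(x² + y²)^{-s/2}` (`0 < s < 2`),
  `|x − y|^{-s}` (a diagonal singularity: after the transformation it sits on the edge `s = 1`), times analytic factors.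

Singularities at another vertex, or at an interior point, reduce to this case by reflecting / splitting the box
(op. cit. Sect. 5.8: "we assume … that the vertex is at the origin").  Logarithmic vertex singularities are outside the
algebraic weight class of the certificate module and are not treated here.

References: [cite: Duffy1982, p. 1260]; [cite: MousaviSukumar2009, Sect. 1 and Appendix A];
[cite: DavisRabinowitz1984, Sect. 5.8]; [cite: DavisRabinowitz1984, Sect. 2.12.5]; [cite: MakinoBerz2003, Algorithm 2];
[cite: MahboubiMelquiondSibutpinote2016, Sect. 3.3].
-/

open MeasureTheory intervalIntegral Set
open scoped Interval

namespace Literature.Analysis.ValidatedNumerics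

namespace PolyMP

open Literature.Analysis.ValidatedNumerics.NumericsMP
open Literature.Analysis.ValidatedNumerics.ExpPoly (Poly)
open Literature.Analysis.ValidatedNumerics.ExpPoly
open Literature.Analysis.ValidatedNumerics.TaylorForm

/-! ### Part A. Joint integrability behind a checked weighted certificate, and Fubini -/

/-- [folklore] -/
private theorem measurable_dirW' (h dl dr αl αr : ℚ) (ml mr : Bool) : Measurable (dirW h dl dr αl αr ml mr) := by
  have h1 : Measurable (wL ml (dl + h) αl) := by
    cases ml
    · have e : wL false (dl + h) αl = fun _ => (1 : ℝ) := by funext u; simp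
      rw [e]; exact measurable_const
    · have e : wL true (dl + h) αl = fun u : ℝ => (u + ((dl + h : ℚ) : ℝ)) ^ (αl : ℝ) := by funext u; simp [wL]
      rw [e]; exact (measurable_id.add_const _).pow_const _
  have h2 : Measurable (wR mr (dr + h) αr) := by
    cases mr
    · have e : wR false (dr + h) αr = fun _ => (1 : ℝ) := by funext u; simp
      rw [e]; exact measurable_const
    · have e : wR true (dr + h) αr = fun u : ℝ => (((dr + h : ℚ) : ℝ) - u) ^ (αr : ℝ) := by funext u; simp [wR]
      rw [e]; exact (measurable_const.sub measurable_id).pow_const _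
  exact h1.mul h2

/-- [folklore] -/
private theorem sep_of_flag' {t : Bool} {α a b : ℚ} (h : (t = true ∨ α = 0) ∨ a < b) : t = false → α ≠ 0 → a < b := by
  intro ht hα
  rcases h with (h | h) | h
  · rw [ht] at h; exact absurd h Bool.false_ne_true
  · exact absurd h hα
  · exact h

/-- **Joint integrability on an accepted leaf**: the weighted integrand `w · F` of an accepted leaf `B` of the
weighted certificate is integrable on the closed leaf `[x0, x1] × [y0, y1]` for the product (Lebesgue) measure — the
tensor weight is a product of integrable one-dimensional Jacobi-type factors and the Taylor-modelled regular part is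
jointly measurable and bounded (op. cit. Sect. 2.12.5: the singular weight is integrated exactly, the regular factor is
bounded). [cite: DavisRabinowitz1984, Sect. 2.12.5] [cite: MakinoBerz2003, Algorithm 2] -/
theorem integrableOn_prod_of_leafEnclW {S : ℕ} (hS : 0 < S) (F : BExprT) (ω : WPrm) (R B : Box2Q) (P : EPrm)
    (hok : (leafEnclW S F ω R B P).2 = true) :
    IntegrableOn (fun p : ℝ × ℝ => wfun ω R F p.1 p.2) (Icc (B.x0 : ℝ) B.x1 ×ˢ Icc (B.y0 : ℝ) B.y1) volume := by
  simp only [leafEnclW, Bool.and_eq_true, Bool.or_eq_true, decide_eq_true_eq] at hok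
  obtain ⟨⟨⟨⟨⟨⟨⟨⟨⟨⟨⟨⟨hacc, hdx⟩, hdy⟩, hsx0⟩, hsx1⟩, hsy0⟩, hsy1⟩, hRx0⟩, hRx1⟩, hRy0⟩, hRy1⟩, hx⟩, hy⟩ := hok
  set h : ℚ := (B.x1 - B.x0) / 2 with hh
  set k : ℚ := (B.y1 - B.y0) / 2 with hk
  set cx : ℚ := (B.x0 + B.x1) / 2 with hcx
  set cy : ℚ := (B.y0 + B.y1) / 2 with hcy
  set dlx : ℚ := B.x0 - R.x0 with hdlx
  set drx : ℚ := R.x1 - B.x1 with hdrx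
  set dly : ℚ := B.y0 - R.y0 with hdly
  set dry : ℚ := R.y1 - B.y1 with hdry
  set px : Bool × Bool := dirPlan h dlx drx ω.xl ω.xr with hpx
  set py : Bool × Bool := dirPlan k dly dry ω.yl ω.yr with hpy
  set G : BExprT := gexpr F ω R px.1 px.2 py.1 py.2 with hG
  have h0 : 0 ≤ h := by rw [hh]; linarith
  have k0 : 0 ≤ k := by rw [hk]; linarith
  have hSr : (0 : ℝ) < S := by exact_mod_cast hS
  have hT := BExprT.tmem2_model hS h0 k0 P cx cy G hacc
  obtain ⟨hXi, -, -⟩ := dirMom_sound (dl := dlx) (dr := drx) (αl := ω.xl) (αr := ω.xr)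
    (ml := px.1) (mr := px.2) h0 hdx
  obtain ⟨hYi, -, -⟩ := dirMom_sound (dl := dly) (dr := dry) (αl := ω.yl) (αr := ω.yr)
    (ml := py.1) (mr := py.2) k0 hdy
  set WX : ℝ → ℝ := dirW h dlx drx ω.xl ω.xr px.1 px.2 with hWX
  set WY : ℝ → ℝ := dirW k dly dry ω.yl ω.yr py.1 py.2 with hWY
  -- the pointwise identity on the closed leaf
  have hcmx0 : cx - (dlx + h) = R.x0 := by rw [hcx, hh, hdlx]; ring
  have hcmx1 : cx + (drx + h) = R.x1 := by rw [hcx, hh, hdrx]; ring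
  have hcmy0 : cy - (dly + k) = R.y0 := by rw [hcy, hk, hdly]; ring
  have hcmy1 : cy + (dry + k) = R.y1 := by rw [hcy, hk, hdry]; ring
  have hpt : ∀ x : ℝ, (B.x0 : ℝ) ≤ x → x ≤ B.x1 → ∀ y : ℝ, (B.y0 : ℝ) ≤ y → y ≤ B.y1 →
      wfun ω R F x y = WX (x - cx) * WY (y - cy) * G.toFun₂ x y := by
    intro x hx0 hx1 y hy0 hy1
    simp only [wfun, edgeW, hWX, hWY, dirW, hG, toFun₂_gexpr]
    rw [rpow_left_split hcmx0 (sep_of_flag' hsx0) hx0, rpow_right_split hcmx1 (sep_of_flag' hsx1) hx1,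
      rpow_left_split hcmy0 (sep_of_flag' hsy0) hy0, rpow_right_split hcmy1 (sep_of_flag' hsy1) hy1]
    ring
  have hxx : (B.x0 : ℝ) ≤ B.x1 := by exact_mod_cast hx
  have hyy : (B.y0 : ℝ) ≤ B.y1 := by exact_mod_cast hy
  have ex0 : -(h : ℝ) + (cx : ℝ) = (B.x0 : ℝ) := by rw [hcx, hh]; push_cast; ring
  have ex1 : (h : ℝ) + (cx : ℝ) = (B.x1 : ℝ) := by rw [hcx, hh]; push_cast; ring
  have ey0 : -(k : ℝ) + (cy : ℝ) = (B.y0 : ℝ) := by rw [hcy, hk]; push_cast; ring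
  have ey1 : (k : ℝ) + (cy : ℝ) = (B.y1 : ℝ) := by rw [hcy, hk]; push_cast; ring
  -- the tensor weight is integrable on the closed leaf
  have hIX : IntegrableOn (fun x : ℝ => WX (x - cx)) (Icc (B.x0 : ℝ) B.x1) volume := by
    have h1 := hXi.comp_sub_right (cx : ℝ)
    rw [ex0, ex1] at h1
    exact (intervalIntegrable_iff_integrableOn_Icc_of_le hxx).1 h1
  have hIY : IntegrableOn (fun y : ℝ => WY (y - cy)) (Icc (B.y0 : ℝ) B.y1) volume := by
    have h1 := hYi.comp_sub_right (cy : ℝ)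
    rw [ey0, ey1] at h1
    exact (intervalIntegrable_iff_integrableOn_Icc_of_le hyy).1 h1
  have hIW : IntegrableOn (fun p : ℝ × ℝ => WX (p.1 - cx) * WY (p.2 - cy))
      (Icc (B.x0 : ℝ) B.x1 ×ˢ Icc (B.y0 : ℝ) B.y1) volume := by
    have h1 := Integrable.mul_prod hIX hIY
    rw [Measure.prod_restrict, ← Measure.volume_eq_prod] at h1
    exact h1
  -- the regular part is jointly measurable and bounded on the closed leaf
  have hGm : AEStronglyMeasurable (fun p : ℝ × ℝ => G.toFun₂ p.1 p.2)
      (volume.restrict (Icc (B.x0 : ℝ) B.x1 ×ˢ Icc (B.y0 : ℝ) B.y1)) :=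
    (BExprT.measurable_toFun₂ G).aestronglyMeasurable
  have hGb : ∀ᵐ p : ℝ × ℝ ∂(volume.restrict (Icc (B.x0 : ℝ) B.x1 ×ˢ Icc (B.y0 : ℝ) B.y1)),
      ‖G.toFun₂ p.1 p.2‖ ≤ (tabs2 S h k (BExprT.model S h k P cx cy G).1 : ℝ) / S := by
    refine (ae_restrict_iff' (measurableSet_Icc.prod measurableSet_Icc)).2
      (Filter.Eventually.of_forall fun p hp => ?_)
    obtain ⟨⟨hp1, hp2⟩, hp3, hp4⟩ := hp
    have hu : |p.1 - (cx : ℝ)| ≤ h := by rw [abs_le]; constructor <;> linarith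
    have hv : |p.2 - (cy : ℝ)| ≤ k := by rw [abs_le]; constructor <;> linarith
    rw [Real.norm_eq_abs, le_div_iff₀ hSr]
    have := abs_le_tabs2 h0 k0 hT hu hv
    simpa only [add_sub_cancel] using this
  have hI : IntegrableOn (fun p : ℝ × ℝ => WX (p.1 - cx) * WY (p.2 - cy) * G.toFun₂ p.1 p.2)
      (Icc (B.x0 : ℝ) B.x1 ×ˢ Icc (B.y0 : ℝ) B.y1) volume := Integrable.mul_bdd hIW hGm hGb
  refine hI.congr_fun (fun p hp => ?_) (measurableSet_Icc.prod measurableSet_Icc)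
  obtain ⟨⟨hp1, hp2⟩, hp3, hp4⟩ := hp
  exact (hpt p.1 hp1 hp2 p.2 hp3 hp4).symm

/-- **Joint integrability behind a checked tree, for an arbitrary leaf rule**: if every accepted leaf is jointly
integrable on its closed box and correctly oriented, so is the root box (the leaves tile the box: structural
induction, splitting `[x0, x1] = [x0, c] ∪ [c, x1]`). [cite: MahboubiMelquiondSibutpinote2016, Sect. 3.3] -/
theorem tree_integrableOn_rule {f : ℝ → ℝ → ℝ} {Λ : Box2Q → EPrm → MI × Bool}
    (hΛ : ∀ (B : Box2Q) (P : EPrm), (Λ B P).2 = true →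
      IntegrableOn (fun p : ℝ × ℝ => f p.1 p.2) (Icc (B.x0 : ℝ) B.x1 ×ˢ Icc (B.y0 : ℝ) B.y1) volume ∧
        B.x0 ≤ B.x1 ∧ B.y0 ≤ B.y1) :
    ∀ (t : KdTree2) (B : Box2Q), leafClaimsOKR Λ (t.leaves B) = true →
      IntegrableOn (fun p : ℝ × ℝ => f p.1 p.2) (Icc (B.x0 : ℝ) B.x1 ×ˢ Icc (B.y0 : ℝ) B.y1) volume ∧
        B.x0 ≤ B.x1 ∧ B.y0 ≤ B.y1
  | KdTree2.leaf P J, B, hok => by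
      simp only [KdTree2.leaves, leafClaimsOKR, List.all_cons, List.all_nil, Bool.and_true, Bool.and_eq_true,
        decide_eq_true_eq] at hok
      exact hΛ B P hok.1.1
  | KdTree2.splitX c L R, B, hok => by
      simp only [KdTree2.leaves, leafClaimsOKR, List.all_append, Bool.and_eq_true] at hok
      obtain ⟨hL, hxL, hyL⟩ := tree_integrableOn_rule hΛ L ⟨B.x0, c, B.y0, B.y1⟩ (by simpa [leafClaimsOKR] using hok.1)
      obtain ⟨hR, hxR, hyR⟩ := tree_integrableOn_rule hΛ R ⟨c, B.x1, B.y0, B.y1⟩ (by simpa [leafClaimsOKR] using hok.2)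
      simp only at hL hxL hyL hR hxR hyR
      refine ⟨?_, hxL.trans hxR, hyL⟩
      have e : (Icc (B.x0 : ℝ) B.x1 ×ˢ Icc (B.y0 : ℝ) B.y1 : Set (ℝ × ℝ)) =
          Icc (B.x0 : ℝ) c ×ˢ Icc (B.y0 : ℝ) B.y1 ∪ Icc (c : ℝ) B.x1 ×ˢ Icc (B.y0 : ℝ) B.y1 := by
        rw [← union_prod, Icc_union_Icc_eq_Icc (by exact_mod_cast hxL) (by exact_mod_cast hxR)]
      rw [e]
      exact hL.union hR
  | KdTree2.splitY c L R, B, hok => by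
      simp only [KdTree2.leaves, leafClaimsOKR, List.all_append, Bool.and_eq_true] at hok
      obtain ⟨hL, hxL, hyL⟩ := tree_integrableOn_rule hΛ L ⟨B.x0, B.x1, B.y0, c⟩ (by simpa [leafClaimsOKR] using hok.1)
      obtain ⟨hR, hxR, hyR⟩ := tree_integrableOn_rule hΛ R ⟨B.x0, B.x1, c, B.y1⟩ (by simpa [leafClaimsOKR] using hok.2)
      simp only at hL hxL hyL hR hxR hyR
      refine ⟨?_, hxL, hyL.trans hyR⟩
      have e : (Icc (B.x0 : ℝ) B.x1 ×ˢ Icc (B.y0 : ℝ) B.y1 : Set (ℝ × ℝ)) =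
          Icc (B.x0 : ℝ) B.x1 ×ˢ Icc (B.y0 : ℝ) c ∪ Icc (B.x0 : ℝ) B.x1 ×ˢ Icc (c : ℝ) B.y1 := by
        rw [← prod_union, Icc_union_Icc_eq_Icc (by exact_mod_cast hyL) (by exact_mod_cast hyR)]
      rw [e]
      exact hL.union hR

/-- [folklore] -/
private theorem leafClaimsOKR_of_leafCheckR' (Λ : Box2Q → EPrm → MI × Bool) (t : KdTree2) (B : Box2Q) {n : ℕ}
    (hn : t.size ≤ n) (H : ∀ i : ℕ, i < n → leafCheckR Λ t B i = true) : leafClaimsOKR Λ (t.leaves B) = true := by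
  unfold leafClaimsOKR
  refine List.all_eq_true.2 fun l hl => ?_
  obtain ⟨i, hi, rfl⟩ := List.getElem_of_mem hl
  have hlt : i < n := lt_of_lt_of_le (by simpa [KdTree2.length_leaves] using hi) hn
  have := H i hlt
  simp only [leafCheckR, List.getElem?_eq_getElem hi] at this
  exact this

/-- **What a checked weighted certificate provides beyond the enclosure**: the weighted integrand
`(x − x0)^{xl} (x1 − x)^{xr} · ((y − y0)^{yl} (y1 − y)^{yr} · F(x, y))` is (jointly) integrable on the closed root box
`[x0, x1] × [y0, y1]`, and the box is correctly oriented. [cite: DavisRabinowitz1984, Sect. 2.12.5]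
[cite: MahboubiMelquiondSibutpinote2016, Sect. 3.3] -/
theorem integrableOn_wfun_of_leafCheckW {S : ℕ} {F : BExprT} {ω : WPrm} {R : Box2Q} {t : KdTree2} {n : ℕ}
    {lo hi : ℚ} (hleaf : ∀ i : ℕ, i < n → leafCheckW S F ω R t i = true) (ht : treeCheckW S t n lo hi = true) :
    IntegrableOn (fun p : ℝ × ℝ => wfun ω R F p.1 p.2) (Icc (R.x0 : ℝ) R.x1 ×ˢ Icc (R.y0 : ℝ) R.y1) volume ∧
      R.x0 ≤ R.x1 ∧ R.y0 ≤ R.y1 := by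
  unfold treeCheckW treeCheckG at ht
  simp only [Bool.and_eq_true, decide_eq_true_eq] at ht
  obtain ⟨⟨⟨hS, hn⟩, -⟩, -⟩ := ht
  refine tree_integrableOn_rule (Λ := leafEnclW S F ω R) (fun B P hok => ⟨integrableOn_prod_of_leafEnclW hS F ω R B P hok,
    (leafEnclW_sound hS F ω R B P hok).2.2.2⟩) t R (leafClaimsOKR_of_leafCheckR' _ t R hn hleaf)

/-- **Fubini on a closed box** (the form used downstream): for a jointly integrable `f` on `[a, b] × [c, d]`
(`a ≤ b`, `c ≤ d`) the iterated interval integral is the integral over the box for the product measure.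
[cite: DavisRabinowitz1984, Sect. 5.6] -/
theorem intervalIntegral_iterated_eq_setIntegral_prod {f : ℝ → ℝ → ℝ} {a b c d : ℝ} (hab : a ≤ b) (hcd : c ≤ d)
    (hf : IntegrableOn (fun p : ℝ × ℝ => f p.1 p.2) (Icc a b ×ˢ Icc c d) volume) :
    ∫ x in a..b, ∫ y in c..d, f x y = ∫ p in Icc a b ×ˢ Icc c d, f p.1 p.2 := by
  have e1 : ∀ x : ℝ, ∫ y in c..d, f x y = ∫ y in Icc c d, f x y := fun x => by
    rw [intervalIntegral.integral_of_le hcd, integral_Icc_eq_integral_Ioc]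
  simp_rw [e1]
  rw [intervalIntegral.integral_of_le hab,
    ← integral_Icc_eq_integral_Ioc (f := fun x => ∫ y in Icc c d, f x y), Measure.volume_eq_prod,
    setIntegral_prod (fun p : ℝ × ℝ => f p.1 p.2) hf]

/-! ### Part B. Duffy's transformation as an identity of set integrals -/

/-- **Duffy's map onto the lower triangle** of the box with vertex `(x0, y0)` and diagonal slope `κ`:
`(x, s) ↦ (x, y0 + κ (x − x0) s)` (op. cit.: `x = u`, `y = u v`, translated and scaled).
[cite: Duffy1982, p. 1260] [cite: MousaviSukumar2009, Appendix A] -/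
def duffyL (κ x0 y0 : ℝ) (p : ℝ × ℝ) : ℝ × ℝ := (p.1, y0 + κ * (p.1 - x0) * p.2)

/-- **Duffy's map onto the upper triangle**: `(y, s) ↦ (x0 + κ' (y − y0) s, y)` (the outer variable is `y`).
[cite: Duffy1982, p. 1260] [cite: MousaviSukumar2009, Appendix A] -/
def duffyU (κ' x0 y0 : ℝ) (p : ℝ × ℝ) : ℝ × ℝ := (x0 + κ' * (p.1 - y0) * p.2, p.1)

/-- The derivative of `duffyL κ x0 y0` at `p`, as the matrix `[[1, 0], [κ s, κ (x − x0)]]`.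
[cite: MousaviSukumar2009, Appendix A] -/
noncomputable def fderivDuffyL (κ x0 : ℝ) (p : ℝ × ℝ) : ℝ × ℝ →L[ℝ] ℝ × ℝ :=
  LinearMap.toContinuousLinearMap
    (Matrix.toLin (Module.Basis.finTwoProd ℝ) (Module.Basis.finTwoProd ℝ) !![1, 0; κ * p.2, κ * (p.1 - x0)])

/-- The derivative of `duffyU κ' x0 y0` at `p`, as the matrix `[[κ' s, κ' (y − y0)], [1, 0]]`.
[cite: MousaviSukumar2009, Appendix A] -/
noncomputable def fderivDuffyU (κ' y0 : ℝ) (p : ℝ × ℝ) : ℝ × ℝ →L[ℝ] ℝ × ℝ :=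
  LinearMap.toContinuousLinearMap
    (Matrix.toLin (Module.Basis.finTwoProd ℝ) (Module.Basis.finTwoProd ℝ) !![κ' * p.2, κ' * (p.1 - y0); 1, 0])

/-- [cite: MousaviSukumar2009, Appendix A] -/
theorem hasFDerivAt_duffyL (κ x0 y0 : ℝ) (p : ℝ × ℝ) :
    HasFDerivAt (duffyL κ x0 y0) (fderivDuffyL κ x0 p) p := by
  have h : HasFDerivAt (duffyL κ x0 y0)
      ((ContinuousLinearMap.fst ℝ ℝ ℝ).prod
        ((κ * (p.1 - x0)) • ContinuousLinearMap.snd ℝ ℝ ℝ + p.2 • (κ • ContinuousLinearMap.fst ℝ ℝ ℝ))) p :=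
    hasFDerivAt_fst.prodMk ((((hasFDerivAt_fst.sub_const x0).const_mul κ).mul hasFDerivAt_snd).const_add y0)
  refine h.congr_fderiv (ContinuousLinearMap.ext fun v => ?_)
  unfold fderivDuffyL
  rw [Matrix.toLin_finTwoProd_toContinuousLinearMap]
  simp only [ContinuousLinearMap.prod_apply, FunLike.coe_add, FunLike.coe_smul,
    Pi.add_apply, Pi.smul_apply, ContinuousLinearMap.coe_fst', ContinuousLinearMap.coe_snd', smul_eq_mul,
    Prod.mk.injEq]
  constructor <;> ring

/-- [cite: MousaviSukumar2009, Appendix A] -/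
theorem hasFDerivAt_duffyU (κ' x0 y0 : ℝ) (p : ℝ × ℝ) :
    HasFDerivAt (duffyU κ' x0 y0) (fderivDuffyU κ' y0 p) p := by
  have h : HasFDerivAt (duffyU κ' x0 y0)
      (((κ' * (p.1 - y0)) • ContinuousLinearMap.snd ℝ ℝ ℝ + p.2 • (κ' • ContinuousLinearMap.fst ℝ ℝ ℝ)).prod
        (ContinuousLinearMap.fst ℝ ℝ ℝ)) p :=
    ((((hasFDerivAt_fst.sub_const y0).const_mul κ').mul hasFDerivAt_snd).const_add x0).prodMk hasFDerivAt_fst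
  refine h.congr_fderiv (ContinuousLinearMap.ext fun v => ?_)
  unfold fderivDuffyU
  rw [Matrix.toLin_finTwoProd_toContinuousLinearMap]
  simp only [ContinuousLinearMap.prod_apply, FunLike.coe_add, FunLike.coe_smul,
    Pi.add_apply, Pi.smul_apply, ContinuousLinearMap.coe_fst', ContinuousLinearMap.coe_snd', smul_eq_mul,
    Prod.mk.injEq]
  constructor <;> ring

/-- The Jacobian determinant of the lower map: `κ (x − x0)` (op. cit.: `J = u`).
[cite: MousaviSukumar2009, Appendix A] -/
theorem det_fderivDuffyL (κ x0 : ℝ) (p : ℝ × ℝ) : (fderivDuffyL κ x0 p).det = κ * (p.1 - x0) := by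
  unfold fderivDuffyL
  simp only [LinearMap.det_toContinuousLinearMap, LinearMap.det_toLin, Matrix.det_fin_two_of]
  ring

/-- The Jacobian determinant of the upper map: `−κ' (y − y0)`. [cite: MousaviSukumar2009, Appendix A] -/
theorem det_fderivDuffyU (κ' y0 : ℝ) (p : ℝ × ℝ) : (fderivDuffyU κ' y0 p).det = -(κ' * (p.1 - y0)) := by
  unfold fderivDuffyU
  simp only [LinearMap.det_toContinuousLinearMap, LinearMap.det_toLin, Matrix.det_fin_two_of]
  ring

/-- The lower map is injective off the edge `x = x0` (`κ > 0`). [cite: Duffy1982, p. 1260] -/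
theorem injOn_duffyL {κ : ℝ} (hκ : 0 < κ) (x0 y0 : ℝ) (t : Set ℝ) : InjOn (duffyL κ x0 y0) (Ioi x0 ×ˢ t) := by
  intro p hp q hq hpq
  rw [Set.mem_prod, Set.mem_Ioi] at hp
  simp only [duffyL, Prod.mk.injEq] at hpq
  obtain ⟨h1, h2⟩ := hpq
  have hpos : 0 < κ * (p.1 - x0) := mul_pos hκ (sub_pos.2 hp.1)
  rw [← h1] at h2
  have h3 : κ * (p.1 - x0) * p.2 = κ * (p.1 - x0) * q.2 := by linarith
  exact Prod.ext h1 (mul_left_cancel₀ hpos.ne' h3)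

/-- The upper map is injective off the edge `y = y0` (`κ' > 0`). [cite: Duffy1982, p. 1260] -/
theorem injOn_duffyU {κ' : ℝ} (hκ : 0 < κ') (x0 y0 : ℝ) (t : Set ℝ) : InjOn (duffyU κ' x0 y0) (Ioi y0 ×ˢ t) := by
  intro p hp q hq hpq
  rw [Set.mem_prod, Set.mem_Ioi] at hp
  simp only [duffyU, Prod.mk.injEq] at hpq
  obtain ⟨h2, h1⟩ := hpq
  have hpos : 0 < κ' * (p.1 - y0) := mul_pos hκ (sub_pos.2 hp.1)
  rw [← h1] at h2
  have h3 : κ' * (p.1 - y0) * p.2 = κ' * (p.1 - y0) * q.2 := by linarith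
  exact Prod.ext h1 (mul_left_cancel₀ hpos.ne' h3)

/-- **The image of the lower map** on `(x0, x1] × [0, 1]` is the lower triangle
`{x0 < x ≤ x1, y0 ≤ y ≤ y0 + κ (x − x0)}` (closed along the diagonal). [cite: Duffy1982, p. 1260] -/
theorem image_duffyL {κ : ℝ} (hκ : 0 < κ) (x0 x1 y0 : ℝ) :
    duffyL κ x0 y0 '' (Ioc x0 x1 ×ˢ Icc 0 1) =
      {p : ℝ × ℝ | x0 < p.1 ∧ p.1 ≤ x1 ∧ y0 ≤ p.2 ∧ p.2 ≤ y0 + κ * (p.1 - x0)} := by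
  ext p
  simp only [Set.mem_image, Set.mem_prod, Set.mem_Ioc, Set.mem_Icc, Set.mem_setOf_eq]
  constructor
  · rintro ⟨q, ⟨⟨hq1, hq2⟩, hq3, hq4⟩, rfl⟩
    have hpos : 0 < κ * (q.1 - x0) := mul_pos hκ (sub_pos.2 hq1)
    refine ⟨hq1, hq2, ?_, ?_⟩
    · show y0 ≤ y0 + κ * (q.1 - x0) * q.2
      nlinarith
    · show y0 + κ * (q.1 - x0) * q.2 ≤ y0 + κ * (q.1 - x0)
      nlinarith
  · rintro ⟨h1, h2, h3, h4⟩
    have hpos : 0 < κ * (p.1 - x0) := mul_pos hκ (sub_pos.2 h1)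
    refine ⟨(p.1, (p.2 - y0) / (κ * (p.1 - x0))), ⟨⟨h1, h2⟩, div_nonneg (by linarith) hpos.le, ?_⟩, ?_⟩
    · rw [div_le_one hpos]; linarith
    · simp only [duffyL]
      rw [mul_div_cancel₀ _ hpos.ne']
      ext <;> simp

/-- **The image of the upper map** on `(y0, y1] × [0, 1)` is the upper triangle
`{y0 < y ≤ y1, x0 ≤ x < x0 + κ' (y − y0)}` (open along the diagonal). [cite: Duffy1982, p. 1260] -/
theorem image_duffyU {κ' : ℝ} (hκ : 0 < κ') (x0 y0 y1 : ℝ) :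
    duffyU κ' x0 y0 '' (Ioc y0 y1 ×ˢ Ico 0 1) =
      {p : ℝ × ℝ | y0 < p.2 ∧ p.2 ≤ y1 ∧ x0 ≤ p.1 ∧ p.1 < x0 + κ' * (p.2 - y0)} := by
  ext p
  simp only [Set.mem_image, Set.mem_prod, Set.mem_Ioc, Set.mem_Ico, Set.mem_setOf_eq]
  constructor
  · rintro ⟨q, ⟨⟨hq1, hq2⟩, hq3, hq4⟩, rfl⟩
    have hpos : 0 < κ' * (q.1 - y0) := mul_pos hκ (sub_pos.2 hq1)
    refine ⟨hq1, hq2, ?_, ?_⟩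
    · show x0 ≤ x0 + κ' * (q.1 - y0) * q.2
      nlinarith
    · show x0 + κ' * (q.1 - y0) * q.2 < x0 + κ' * (q.1 - y0)
      nlinarith
  · rintro ⟨h1, h2, h3, h4⟩
    have hpos : 0 < κ' * (p.2 - y0) := mul_pos hκ (sub_pos.2 h1)
    refine ⟨(p.2, (p.1 - x0) / (κ' * (p.2 - y0))), ⟨⟨h1, h2⟩, div_nonneg (by linarith) hpos.le, ?_⟩, ?_⟩
    · rw [div_lt_one hpos]; linarith
    · simp only [duffyU]
      rw [mul_div_cancel₀ _ hpos.ne']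
      ext <;> simp

/-- [folklore] -/
private theorem Ioc_prod_Icc_ae_eq (a b c d : ℝ) :
    (Ioc a b ×ˢ Icc c d : Set (ℝ × ℝ)) =ᵐ[volume] (Icc a b ×ˢ Icc c d : Set (ℝ × ℝ)) := by
  rw [Measure.volume_eq_prod]
  exact Measure.set_prod_ae_eq Ioc_ae_eq_Icc (Filter.EventuallyEq.refl _ _)

/-- [folklore] -/
private theorem Ioc_prod_Ico_ae_eq (a b c d : ℝ) :
    (Ioc a b ×ˢ Ico c d : Set (ℝ × ℝ)) =ᵐ[volume] (Icc a b ×ˢ Icc c d : Set (ℝ × ℝ)) := by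
  rw [Measure.volume_eq_prod]
  exact Measure.set_prod_ae_eq Ioc_ae_eq_Icc Ico_ae_eq_Icc

/-- **Duffy's substitution on the lower triangle** (no hypothesis on `f`):
`∫_{T_L} f = ∫_{[x0,x1]×[0,1]} κ (x − x0) · f(x, y0 + κ (x − x0) s)` and `f` is integrable on `T_L` iff the
transformed integrand is integrable on the closed box. [cite: Duffy1982, p. 1260] [cite: MousaviSukumar2009, Appendix A] -/
theorem setIntegral_duffyL {κ : ℝ} (hκ : 0 < κ) (x0 x1 y0 : ℝ) (f : ℝ × ℝ → ℝ) :
    (∫ p in {p : ℝ × ℝ | x0 < p.1 ∧ p.1 ≤ x1 ∧ y0 ≤ p.2 ∧ p.2 ≤ y0 + κ * (p.1 - x0)}, f p =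
        ∫ p in Icc x0 x1 ×ˢ Icc (0 : ℝ) 1, κ * (p.1 - x0) * f (p.1, y0 + κ * (p.1 - x0) * p.2)) ∧
      (IntegrableOn f {p : ℝ × ℝ | x0 < p.1 ∧ p.1 ≤ x1 ∧ y0 ≤ p.2 ∧ p.2 ≤ y0 + κ * (p.1 - x0)} volume ↔
        IntegrableOn (fun p : ℝ × ℝ => κ * (p.1 - x0) * f (p.1, y0 + κ * (p.1 - x0) * p.2))
          (Icc x0 x1 ×ˢ Icc (0 : ℝ) 1) volume) := by
  have hs : MeasurableSet (Ioc x0 x1 ×ˢ Icc (0 : ℝ) 1 : Set (ℝ × ℝ)) := measurableSet_Ioc.prod measurableSet_Icc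
  have hf' : ∀ p ∈ (Ioc x0 x1 ×ˢ Icc (0 : ℝ) 1 : Set (ℝ × ℝ)),
      HasFDerivWithinAt (duffyL κ x0 y0) (fderivDuffyL κ x0 p) (Ioc x0 x1 ×ˢ Icc (0 : ℝ) 1) p :=
    fun p _ => (hasFDerivAt_duffyL κ x0 y0 p).hasFDerivWithinAt
  have hinj : InjOn (duffyL κ x0 y0) (Ioc x0 x1 ×ˢ Icc (0 : ℝ) 1) :=
    (injOn_duffyL hκ x0 y0 (Icc 0 1)).mono (prod_mono Ioc_subset_Ioi_self Subset.rfl)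
  have heqOn : EqOn (fun p : ℝ × ℝ => |(fderivDuffyL κ x0 p).det| • f (duffyL κ x0 y0 p))
      (fun p : ℝ × ℝ => κ * (p.1 - x0) * f (p.1, y0 + κ * (p.1 - x0) * p.2)) (Ioc x0 x1 ×ˢ Icc (0 : ℝ) 1) := by
    intro p hp
    rw [Set.mem_prod, Set.mem_Ioc] at hp
    simp only [det_fderivDuffyL, smul_eq_mul, duffyL]
    rw [abs_of_nonneg (mul_nonneg hκ.le (sub_nonneg.2 hp.1.1.le))]
  rw [← image_duffyL hκ x0 x1 y0]
  constructor
  · rw [integral_image_eq_integral_abs_det_fderiv_smul volume hs hf' hinj f, setIntegral_congr_fun hs heqOn,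
      setIntegral_congr_set (Ioc_prod_Icc_ae_eq x0 x1 0 1)]
  · rw [integrableOn_image_iff_integrableOn_abs_det_fderiv_smul volume hs hf' hinj f,
      integrableOn_congr_fun heqOn hs]
    exact ⟨fun h => h.congr_set_ae (Ioc_prod_Icc_ae_eq x0 x1 0 1).symm,
      fun h => h.congr_set_ae (Ioc_prod_Icc_ae_eq x0 x1 0 1)⟩

/-- **Duffy's substitution on the upper triangle** (no hypothesis on `f`):
`∫_{T_U} f = ∫_{[y0,y1]×[0,1]} κ' (y − y0) · f(x0 + κ' (y − y0) s, y)`, with the transfer of integrability.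
[cite: Duffy1982, p. 1260] [cite: MousaviSukumar2009, Appendix A] -/
theorem setIntegral_duffyU {κ' : ℝ} (hκ : 0 < κ') (x0 y0 y1 : ℝ) (f : ℝ × ℝ → ℝ) :
    (∫ p in {p : ℝ × ℝ | y0 < p.2 ∧ p.2 ≤ y1 ∧ x0 ≤ p.1 ∧ p.1 < x0 + κ' * (p.2 - y0)}, f p =
        ∫ p in Icc y0 y1 ×ˢ Icc (0 : ℝ) 1, κ' * (p.1 - y0) * f (x0 + κ' * (p.1 - y0) * p.2, p.1)) ∧
      (IntegrableOn f {p : ℝ × ℝ | y0 < p.2 ∧ p.2 ≤ y1 ∧ x0 ≤ p.1 ∧ p.1 < x0 + κ' * (p.2 - y0)} volume ↔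
        IntegrableOn (fun p : ℝ × ℝ => κ' * (p.1 - y0) * f (x0 + κ' * (p.1 - y0) * p.2, p.1))
          (Icc y0 y1 ×ˢ Icc (0 : ℝ) 1) volume) := by
  have hs : MeasurableSet (Ioc y0 y1 ×ˢ Ico (0 : ℝ) 1 : Set (ℝ × ℝ)) := measurableSet_Ioc.prod measurableSet_Ico
  have hf' : ∀ p ∈ (Ioc y0 y1 ×ˢ Ico (0 : ℝ) 1 : Set (ℝ × ℝ)),
      HasFDerivWithinAt (duffyU κ' x0 y0) (fderivDuffyU κ' y0 p) (Ioc y0 y1 ×ˢ Ico (0 : ℝ) 1) p :=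
    fun p _ => (hasFDerivAt_duffyU κ' x0 y0 p).hasFDerivWithinAt
  have hinj : InjOn (duffyU κ' x0 y0) (Ioc y0 y1 ×ˢ Ico (0 : ℝ) 1) :=
    (injOn_duffyU hκ x0 y0 (Ico 0 1)).mono (prod_mono Ioc_subset_Ioi_self Subset.rfl)
  have heqOn : EqOn (fun p : ℝ × ℝ => |(fderivDuffyU κ' y0 p).det| • f (duffyU κ' x0 y0 p))
      (fun p : ℝ × ℝ => κ' * (p.1 - y0) * f (x0 + κ' * (p.1 - y0) * p.2, p.1)) (Ioc y0 y1 ×ˢ Ico (0 : ℝ) 1) := by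
    intro p hp
    rw [Set.mem_prod, Set.mem_Ioc] at hp
    simp only [det_fderivDuffyU, smul_eq_mul, duffyU, abs_neg]
    rw [abs_of_nonneg (mul_nonneg hκ.le (sub_nonneg.2 hp.1.1.le))]
  rw [← image_duffyU hκ x0 y0 y1]
  constructor
  · rw [integral_image_eq_integral_abs_det_fderiv_smul volume hs hf' hinj f, setIntegral_congr_fun hs heqOn,
      setIntegral_congr_set (Ioc_prod_Ico_ae_eq y0 y1 0 1)]
  · rw [integrableOn_image_iff_integrableOn_abs_det_fderiv_smul volume hs hf' hinj f,
      integrableOn_congr_fun heqOn hs]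
    exact ⟨fun h => h.congr_set_ae (Ioc_prod_Ico_ae_eq y0 y1 0 1).symm,
      fun h => h.congr_set_ae (Ioc_prod_Ico_ae_eq y0 y1 0 1)⟩

/-- **Duffy's decomposition of a box along the diagonal through the singular vertex** `(x0, y0)`: with
`κ (x1 − x0) = y1 − y0` and `κ' (y1 − y0) = x1 − x0`, if the two transformed integrands are integrable on their closed
boxes then `f` is integrable on `[x0, x1] × [y0, y1]` and
`∫_R f = ∫_{[x0,x1]×[0,1]} κ (x − x0) f(x, y0 + κ (x − x0) s) + ∫_{[y0,y1]×[0,1]} κ' (y − y0) f(x0 + κ' (y − y0) s, y)`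
(the square "can be divided into triangles … with the singularity lying at a vertex … and the transformation can be
applied to each subdomain separately", op. cit. Sect. 1). [cite: Duffy1982, p. 1260] [cite: MousaviSukumar2009, Sect. 1] -/
theorem duffy_split {x0 x1 y0 y1 κ κ' : ℝ} (hx : x0 < x1) (hy : y0 < y1) (hκ : κ * (x1 - x0) = y1 - y0)
    (hκ' : κ' * (y1 - y0) = x1 - x0) {f : ℝ × ℝ → ℝ}
    (h₁ : IntegrableOn (fun p : ℝ × ℝ => κ * (p.1 - x0) * f (p.1, y0 + κ * (p.1 - x0) * p.2))
      (Icc x0 x1 ×ˢ Icc (0 : ℝ) 1) volume)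
    (h₂ : IntegrableOn (fun p : ℝ × ℝ => κ' * (p.1 - y0) * f (x0 + κ' * (p.1 - y0) * p.2, p.1))
      (Icc y0 y1 ×ˢ Icc (0 : ℝ) 1) volume) :
    IntegrableOn f (Icc x0 x1 ×ˢ Icc y0 y1) volume ∧
      ∫ p in Icc x0 x1 ×ˢ Icc y0 y1, f p =
        (∫ p in Icc x0 x1 ×ˢ Icc (0 : ℝ) 1, κ * (p.1 - x0) * f (p.1, y0 + κ * (p.1 - x0) * p.2)) +
          ∫ p in Icc y0 y1 ×ˢ Icc (0 : ℝ) 1, κ' * (p.1 - y0) * f (x0 + κ' * (p.1 - y0) * p.2, p.1) := by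
  have hκ0 : 0 < κ := by
    by_contra h
    have h' := not_lt.1 h
    nlinarith [sub_pos.2 hx, sub_pos.2 hy]
  have hκ'0 : 0 < κ' := by
    by_contra h
    have h' := not_lt.1 h
    nlinarith [sub_pos.2 hx, sub_pos.2 hy]
  have hκκ : κ' * κ = 1 := by
    have h3 : κ' * κ * (x1 - x0) = 1 * (x1 - x0) := by rw [mul_assoc, hκ, hκ', one_mul]
    exact mul_right_cancel₀ (sub_pos.2 hx).ne' h3
  set TL : Set (ℝ × ℝ) := {p : ℝ × ℝ | x0 < p.1 ∧ p.1 ≤ x1 ∧ y0 ≤ p.2 ∧ p.2 ≤ y0 + κ * (p.1 - x0)} with hTL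
  set TU : Set (ℝ × ℝ) := {p : ℝ × ℝ | y0 < p.2 ∧ p.2 ≤ y1 ∧ x0 ≤ p.1 ∧ p.1 < x0 + κ' * (p.2 - y0)} with hTU
  obtain ⟨eL, iL⟩ := setIntegral_duffyL hκ0 x0 x1 y0 f
  obtain ⟨eU, iU⟩ := setIntegral_duffyU hκ'0 x0 y0 y1 f
  rw [← hTL] at eL iL
  rw [← hTU] at eU iU
  have hfL : IntegrableOn f TL volume := iL.2 h₁
  have hfU : IntegrableOn f TU volume := iU.2 h₂
  -- the two triangles are disjoint and tile the box up to the vertex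
  have hdisj : Disjoint TL TU := by
    refine Set.disjoint_left.2 fun p hL hU => ?_
    rw [hTL, Set.mem_setOf_eq] at hL
    rw [hTU, Set.mem_setOf_eq] at hU
    have key : κ' * (κ * (p.1 - x0)) = p.1 - x0 := by rw [← mul_assoc, hκκ, one_mul]
    have h4 : κ' * (p.2 - y0) ≤ κ' * (κ * (p.1 - x0)) := mul_le_mul_of_nonneg_left (by linarith [hL.2.2.2]) hκ'0.le
    rw [key] at h4
    linarith [hU.2.2.2]
  have hTUm : MeasurableSet TU := by
    have e : TU = ({p : ℝ × ℝ | y0 < p.2} ∩ {p : ℝ × ℝ | p.2 ≤ y1}) ∩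
        ({p : ℝ × ℝ | x0 ≤ p.1} ∩ {p : ℝ × ℝ | p.1 < x0 + κ' * (p.2 - y0)}) := by
      ext p
      simp only [hTU, Set.mem_setOf_eq, Set.mem_inter_iff]
      tauto
    rw [e]
    exact ((measurableSet_lt measurable_const measurable_snd).inter
      (measurableSet_le measurable_snd measurable_const)).inter
      ((measurableSet_le measurable_const measurable_fst).inter
        (measurableSet_lt measurable_fst (measurable_const.add (measurable_const.mul
          (measurable_snd.sub measurable_const)))))
  have hsub : TL ∪ TU ⊆ Icc x0 x1 ×ˢ Icc y0 y1 := by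
    rintro p (hL | hU)
    · rw [hTL, Set.mem_setOf_eq] at hL
      obtain ⟨h1, h2, h3, h4⟩ := hL
      have h5 : κ * (p.1 - x0) ≤ κ * (x1 - x0) := mul_le_mul_of_nonneg_left (by linarith) hκ0.le
      rw [hκ] at h5
      exact ⟨⟨h1.le, h2⟩, h3, by linarith⟩
    · rw [hTU, Set.mem_setOf_eq] at hU
      obtain ⟨h1, h2, h3, h4⟩ := hU
      have h5 : κ' * (p.2 - y0) ≤ κ' * (y1 - y0) := mul_le_mul_of_nonneg_left (by linarith) hκ'0.le
      rw [hκ'] at h5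
      exact ⟨⟨h3, by linarith⟩, h1.le, h2⟩
  have hcov : Icc x0 x1 ×ˢ Icc y0 y1 \ (TL ∪ TU) ⊆ {(x0, y0)} := by
    rintro p ⟨hp, hn⟩
    rw [Set.mem_prod, Set.mem_Icc, Set.mem_Icc] at hp
    obtain ⟨⟨h1, h2⟩, h3, h4⟩ := hp
    rw [Set.mem_union, not_or, hTL, hTU, Set.mem_setOf_eq, Set.mem_setOf_eq] at hn
    obtain ⟨hnL, hnU⟩ := hn
    rw [Set.mem_singleton_iff]
    rcases le_or_gt p.2 (y0 + κ * (p.1 - x0)) with hle | hlt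
    · -- below the diagonal: not in `TL` forces `x = x0`, then `y = y0`
      have hx0 : p.1 = x0 := by
        by_contra hne
        exact hnL ⟨lt_of_le_of_ne h1 (Ne.symm hne), h2, h3, hle⟩
      have hy0 : p.2 = y0 := by
        rw [hx0, sub_self, mul_zero, add_zero] at hle
        exact le_antisymm hle h3
      exact Prod.ext hx0 hy0
    · -- strictly above the diagonal: the point lies in `TU`
      exfalso
      have hy0 : y0 < p.2 := by nlinarith [mul_nonneg hκ0.le (sub_nonneg.2 h1)]
      have key : κ' * (κ * (p.1 - x0)) = p.1 - x0 := by rw [← mul_assoc, hκκ, one_mul]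
      have h5 : κ' * (κ * (p.1 - x0)) < κ' * (p.2 - y0) := mul_lt_mul_of_pos_left (by linarith) hκ'0
      rw [key] at h5
      exact hnU ⟨hy0, h4, h1, by linarith⟩
  have hae : (TL ∪ TU : Set (ℝ × ℝ)) =ᵐ[volume] (Icc x0 x1 ×ˢ Icc y0 y1 : Set (ℝ × ℝ)) := by
    refine ae_eq_set.2 ⟨?_, ?_⟩
    · exact measure_mono_null (fun p hp => (hp.2 (hsub hp.1)).elim) measure_empty
    · exact measure_mono_null hcov (measure_singleton _)
  have hfLU : IntegrableOn f (TL ∪ TU) volume := hfL.union hfU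
  refine ⟨hfLU.congr_set_ae hae.symm, ?_⟩
  rw [← setIntegral_congr_set hae, setIntegral_union hdisj hTUm hfL hfU, eL, eU]

/-! ### Part C. The certificate for a vertex singularity -/

/-- [folklore] -/
private theorem Icc_prod_Icc_ae_eq_Ioo (a b c d : ℝ) :
    (Icc a b ×ˢ Icc c d : Set (ℝ × ℝ)) =ᵐ[volume] (Ioo a b ×ˢ Ioo c d : Set (ℝ × ℝ)) := by
  rw [Measure.volume_eq_prod]
  exact Measure.set_prod_ae_eq Ioo_ae_eq_Icc.symm Ioo_ae_eq_Icc.symm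

/-- [folklore] -/
private theorem transfer_open_box {g w : ℝ × ℝ → ℝ} {a b c d : ℝ}
    (heq : ∀ p : ℝ × ℝ, a < p.1 → p.1 < b → c < p.2 → p.2 < d → g p = w p)
    (hw : IntegrableOn w (Icc a b ×ˢ Icc c d) volume) :
    IntegrableOn g (Icc a b ×ˢ Icc c d) volume ∧
      ∫ p in Icc a b ×ˢ Icc c d, g p = ∫ p in Icc a b ×ˢ Icc c d, w p := by
  have hae := Icc_prod_Icc_ae_eq_Ioo a b c d
  have heqOn : EqOn g w (Ioo a b ×ˢ Ioo c d) := by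
    intro p hp
    rw [Set.mem_prod, Set.mem_Ioo, Set.mem_Ioo] at hp
    exact heq p hp.1.1 hp.1.2 hp.2.1 hp.2.2
  have hm : MeasurableSet (Ioo a b ×ˢ Ioo c d : Set (ℝ × ℝ)) := measurableSet_Ioo.prod measurableSet_Ioo
  refine ⟨((integrableOn_congr_fun heqOn hm).2 (hw.congr_set_ae hae.symm)).congr_set_ae hae, ?_⟩
  rw [setIntegral_congr_set hae, setIntegral_congr_set hae, setIntegral_congr_fun hm heqOn]

/-- **Kernel-checked bounds for an integrand with an algebraic singularity at the vertex `(x0, y0)`** of the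
rational box `R = [x0, x1] × [y0, y1]` (Duffy's transformation composed with the weighted kd-tree certificate;
`κ₁ = (y1 − y0)/(x1 − x0)`, `κ₂ = (x1 − x0)/(y1 − y0)` given as rationals).  HYPOTHESES ON `f`: only the two pointwise
identities on the OPEN boxes `(x0, x1) × (0, 1)` and `(y0, y1) × (0, 1)` exhibiting the transformed integrands
`κ₁ (x − x0) f(x, y0 + κ₁ (x − x0) s)` and `κ₂ (y − y0) f(x0 + κ₂ (y − y0) s, y)` as weighted code-list integrands
`(x − x0)^{xl} (x1 − x)^{xr} s^{yl} (1 − s)^{yr} Fᵢ(x, s)` (a vertex singularity `r^{−σ}`, `σ < 2`, becomes the edge weight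
`(x − x0)^{1−σ}`; a diagonal singularity `|x − y|^{−σ}` becomes the edge weight `(1 − s)^{−σ}`), plus the `decide`-able
obligations of the two certificates.  CONCLUSION: `f` is integrable on the closed box and
`lo₁ + lo₂ ≤ ∫_{x0}^{x1} ∫_{y0}^{y1} f(x, y) dy dx ≤ hi₁ + hi₂`.
[cite: Duffy1982, p. 1260] [cite: DavisRabinowitz1984, Sect. 5.8] [cite: DavisRabinowitz1984, Sect. 2.12.5]
[cite: MakinoBerz2003, Algorithm 2] [cite: MahboubiMelquiondSibutpinote2016, Sect. 3.3] -/
theorem integral_bounds_of_duffyCheckW {S : ℕ} {R : Box2Q} {κ₁ κ₂ : ℚ} (hx : R.x0 < R.x1) (hy : R.y0 < R.y1)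
    (hκ₁ : κ₁ * (R.x1 - R.x0) = R.y1 - R.y0) (hκ₂ : κ₂ * (R.y1 - R.y0) = R.x1 - R.x0)
    {f : ℝ → ℝ → ℝ} {F₁ F₂ : BExprT} {ω₁ ω₂ : WPrm} {t₁ t₂ : KdTree2} {n₁ n₂ : ℕ} {lo₁ hi₁ lo₂ hi₂ : ℚ}
    (hf₁ : ∀ x s : ℝ, (R.x0 : ℝ) < x → x < R.x1 → 0 < s → s < 1 →
      (κ₁ : ℝ) * (x - R.x0) * f x (R.y0 + κ₁ * (x - R.x0) * s) = wfun ω₁ ⟨R.x0, R.x1, 0, 1⟩ F₁ x s)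
    (hf₂ : ∀ y s : ℝ, (R.y0 : ℝ) < y → y < R.y1 → 0 < s → s < 1 →
      (κ₂ : ℝ) * (y - R.y0) * f (R.x0 + κ₂ * (y - R.y0) * s) y = wfun ω₂ ⟨R.y0, R.y1, 0, 1⟩ F₂ y s)
    (hleaf₁ : ∀ i : ℕ, i < n₁ → leafCheckW S F₁ ω₁ ⟨R.x0, R.x1, 0, 1⟩ t₁ i = true)
    (ht₁ : treeCheckW S t₁ n₁ lo₁ hi₁ = true)
    (hleaf₂ : ∀ i : ℕ, i < n₂ → leafCheckW S F₂ ω₂ ⟨R.y0, R.y1, 0, 1⟩ t₂ i = true)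
    (ht₂ : treeCheckW S t₂ n₂ lo₂ hi₂ = true) :
    IntegrableOn (fun p : ℝ × ℝ => f p.1 p.2) (Icc (R.x0 : ℝ) R.x1 ×ˢ Icc (R.y0 : ℝ) R.y1) volume ∧
      ((lo₁ + lo₂ : ℚ) : ℝ) ≤ ∫ x in (R.x0 : ℝ)..R.x1, ∫ y in (R.y0 : ℝ)..R.y1, f x y ∧
      ∫ x in (R.x0 : ℝ)..R.x1, ∫ y in (R.y0 : ℝ)..R.y1, f x y ≤ ((hi₁ + hi₂ : ℚ) : ℝ) := by
  -- the two weighted certificates: enclosures and joint integrability, then Fubini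
  obtain ⟨hlo₁, hhi₁⟩ := integral_bounds_of_leafCheckR (f := wfun ω₁ ⟨R.x0, R.x1, 0, 1⟩ F₁)
    (Λ := leafEnclW S F₁ ω₁ ⟨R.x0, R.x1, 0, 1⟩) (fun hS B P hok => leafEnclW_sound hS F₁ ω₁ _ B P hok) hleaf₁ ht₁
  obtain ⟨hlo₂, hhi₂⟩ := integral_bounds_of_leafCheckR (f := wfun ω₂ ⟨R.y0, R.y1, 0, 1⟩ F₂)
    (Λ := leafEnclW S F₂ ω₂ ⟨R.y0, R.y1, 0, 1⟩) (fun hS B P hok => leafEnclW_sound hS F₂ ω₂ _ B P hok) hleaf₂ ht₂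
  obtain ⟨hI₁, -, -⟩ := integrableOn_wfun_of_leafCheckW hleaf₁ ht₁
  obtain ⟨hI₂, -, -⟩ := integrableOn_wfun_of_leafCheckW hleaf₂ ht₂
  simp only [Rat.cast_zero, Rat.cast_one] at hlo₁ hhi₁ hlo₂ hhi₂ hI₁ hI₂
  have hxr : (R.x0 : ℝ) < R.x1 := by exact_mod_cast hx
  have hyr : (R.y0 : ℝ) < R.y1 := by exact_mod_cast hy
  rw [intervalIntegral_iterated_eq_setIntegral_prod hxr.le zero_le_one hI₁] at hlo₁ hhi₁
  rw [intervalIntegral_iterated_eq_setIntegral_prod hyr.le zero_le_one hI₂] at hlo₂ hhi₂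
  -- the transformed integrands agree with the weighted integrands on the open boxes
  obtain ⟨hg₁, eg₁⟩ := transfer_open_box
    (g := fun p : ℝ × ℝ => (κ₁ : ℝ) * (p.1 - R.x0) * f p.1 (R.y0 + κ₁ * (p.1 - R.x0) * p.2))
    (w := fun p : ℝ × ℝ => wfun ω₁ ⟨R.x0, R.x1, 0, 1⟩ F₁ p.1 p.2)
    (fun p h1 h2 h3 h4 => hf₁ p.1 p.2 h1 h2 h3 h4) hI₁
  obtain ⟨hg₂, eg₂⟩ := transfer_open_box
    (g := fun p : ℝ × ℝ => (κ₂ : ℝ) * (p.1 - R.y0) * f (R.x0 + κ₂ * (p.1 - R.y0) * p.2) p.1)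
    (w := fun p : ℝ × ℝ => wfun ω₂ ⟨R.y0, R.y1, 0, 1⟩ F₂ p.1 p.2)
    (fun p h1 h2 h3 h4 => hf₂ p.1 p.2 h1 h2 h3 h4) hI₂
  -- Duffy's decomposition
  have hκ₁r : (κ₁ : ℝ) * (R.x1 - R.x0) = R.y1 - R.y0 := by exact_mod_cast hκ₁
  have hκ₂r : (κ₂ : ℝ) * (R.y1 - R.y0) = R.x1 - R.x0 := by exact_mod_cast hκ₂
  obtain ⟨hIf, ef⟩ := duffy_split (f := fun p : ℝ × ℝ => f p.1 p.2) hxr hyr hκ₁r hκ₂r hg₁ hg₂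
  refine ⟨hIf, ?_, ?_⟩
  · rw [intervalIntegral_iterated_eq_setIntegral_prod hxr.le hyr.le hIf, ef, eg₁, eg₂]
    push_cast
    linarith
  · rw [intervalIntegral_iterated_eq_setIntegral_prod hxr.le hyr.le hIf, ef, eg₁, eg₂]
    push_cast
    linarith

end PolyMP

end Literature.Analysis.ValidatedNumerics
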